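import Literature.Probability.Process.HarrisSemigroup
import HarnessLib

/-!
# Harris' theorem with constants UNIFORM over a family of Markov kernels / semigroups

Helper file for item stmt-AtomisticToContinuum-9144 (`ResponseDensity`, route
`OddSectorIrreversibility`, sub-problem `FouriersLaw` of `AtomisticToContinuum`): the abstract
input of the last remaining hypothesis of the item (the exponential convergence (2.5) with constants
uniform for bath temperatures near equilibrium). Hairer–Mattingly's proof of Harris' theorem
(`Literature/Probability/Process/HarrisTheorem.lean`) produces the contraction factor `ᾱ` and the
weight `β` as EXPLICIT functions of the drift constants `(γ, K)`, the minorisation constant `α` and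
the level `R`; hence a FAMILY of kernels satisfying the drift and minorisation conditions with the
same constants converges with the same rate. This file records that bookkeeping:

* `uniformHarris_pow` — for all Markov kernels `P` with `PV ≤ γV + K` and `P(x,·) ≥ α ν_P` on
  `{V ≤ R}` (`ν_P` a probability measure, `2K < (1-γ)R`): uniqueness of the invariant probability
  measure, `∫ V dμ ≤ K/(1-γ)`, and `|Pⁿφ(x) - μ(φ)| ≤ ᾱⁿ (2 + βV(x) + β μ(V))` for `|φ| ≤ 1 + βV`,
  with ONE pair `(ᾱ, β)` for the whole family;
* `uniformHarris_semigroup` — for a family of Markov semigroups `κ i` with a common drift at a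
  common time `t₀ > 0`, a common minorisation at `t₀` and a common flow bound `κ i s V ≤ e^{C⋆s} V`:
  `|κ i t f(z) - μ(f)| ≤ C (1 + V z) e^{-ct}` for every `i`, every invariant probability measure
  `μ` of `κ i`, all `z`, `t ≥ 0` and measurable `|f| ≤ V`, with ONE pair `(C, c)`.

No definitions.
-/

noncomputable section

open MeasureTheory ProbabilityTheory Filter Set
open scoped NNReal ENNReal Topology

namespace Summit.AtomisticToContinuum.FouriersLaw.Theorems

open Literature.Probability.Process

variable {X : Type*} [MeasurableSpace X]

/-- **Harris' theorem, uniformly over a family of kernels** (Hairer–Mattingly 2011, Thms 1.2–1.3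
with the constants of Thm 3.1 made explicit): for `V` measurable, `γ < 1`, `α > 0`,
`2K < (1-γ)R` there are `ᾱ ∈ (0,1)` and `β > 0` such that EVERY Markov kernel `P` with
`PV ≤ γV + K` and `P(x,·) ≥ α ν` on `{V ≤ R}` for some probability measure `ν` has: at most one
invariant probability measure; and for every invariant probability measure `μ`,
`∫ V dμ ≤ K/(1-γ)` and `|Pⁿφ(x) - μ(φ)| ≤ ᾱⁿ (2 + βV(x) + β μ(V))` for measurable `|φ| ≤ 1 + βV`. -/
theorem uniformHarris_pow {V : X → ℝ≥0} (hV : Measurable V) {γ K : ℝ≥0} (hγ : γ < 1)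
    {α R : ℝ≥0} (hα : 0 < α) (hR : 2 * K < (1 - γ) * R) :
    ∃ abar β : ℝ, 0 < abar ∧ abar < 1 ∧ 0 < β ∧
      ∀ (P : Kernel X X) [IsMarkovKernel P], (∀ x, ∫⁻ y, V y ∂(P x) ≤ (γ : ℝ≥0∞) * V x + K) →
        ∀ (ν : Measure X) [IsProbabilityMeasure ν], (∀ x, V x ≤ R → α • ν ≤ P x) →
          (∀ μ₁ μ₂ : Measure X, IsProbabilityMeasure μ₁ → IsProbabilityMeasure μ₂ →
            Kernel.Invariant P μ₁ → Kernel.Invariant P μ₂ → μ₁ = μ₂) ∧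
          (∀ μ : Measure X, IsProbabilityMeasure μ → Kernel.Invariant P μ →
            ∫⁻ x, V x ∂μ ≤ ((K / (1 - γ) : ℝ≥0) : ℝ≥0∞) ∧
            ∀ (n : ℕ) (φ : X → ℝ), Measurable φ → (∀ x, |φ x| ≤ 1 + β * V x) → ∀ x,
              |∫ z, φ z ∂((P ^ n) x) - ∫ z, φ z ∂μ| ≤
                abar ^ n * (2 + β * V x + β * (∫⁻ z, V z ∂μ).toReal)) := by
  -- the explicit constants of Hairer–Mattingly, Thm 3.1: `α₀ = α/2`, `β = α/(2(K+1))`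
  set α₀ : ℝ := α / 2 with hα₀
  set β : ℝ := α / (2 * (K + 1)) with hβdef
  have hα' : (0 : ℝ) < α := by exact_mod_cast hα
  have hK0 : (0 : ℝ) ≤ K := K.coe_nonneg
  have hβ : 0 < β := by positivity
  have hβK : β * K ≤ α₀ := by
    rw [hβdef, hα₀, div_mul_eq_mul_div, div_le_div_iff₀ (by positivity) (by positivity)]
    nlinarith
  have hα₀α : α₀ < α := by rw [hα₀]; linarith
  set abar : ℝ := max (max (1 - α + α₀) γ) ((2 + β * R * (γ + 2 * K / R)) / (2 + β * R)) with habar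
  have h0 : 0 < abar := Harris.contractionFactor_pos hβ
  have h1 : abar < 1 := Harris.contractionFactor_lt_one hγ hR hα₀α hβ
  refine ⟨abar, β, h0, h1, hβ, fun P _ hdrift ν _ hminor => ?_⟩
  -- the contraction of the `d_β`-Lipschitz seminorm for this `P`
  have hcontr : ∀ (φ : X → ℝ), Measurable φ → ∀ M : ℝ, 0 ≤ M →
      (∀ x y, |φ x - φ y| ≤ M * (2 + β * V x + β * V y)) →
      ∀ x y, |∫ z, φ z ∂(P x) - ∫ z, φ z ∂(P y)| ≤ abar * M * (2 + β * V x + β * V y) :=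
    fun φ hφm M hM hφ x y => Harris.abs_integral_sub_integral_le P hV hγ hdrift hR hminor hβ hβK hφm hM hφ x y
  refine ⟨fun μ₁ μ₂ _ _ hμ₁ hμ₂ => Harris.invariant_unique P hV hγ hdrift hβ.le hcontr h0.le h1 hμ₁ hμ₂,
    fun μ _ hμ => ⟨Harris.lintegral_le_of_invariant P hV hγ hdrift hμ, fun n φ hφm hφ x => ?_⟩⟩
  have hLip : ∀ x y, |φ x - φ y| ≤ (1 : ℝ) * (2 + β * V x + β * V y) := by
    intro x y
    have := abs_sub (φ x) (φ y)
    linarith [hφ x, hφ y]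
  simpa using Harris.abs_integral_pow_sub_integral_le P hV hγ hdrift hcontr h0.le hμ n hφm zero_le_one
    hLip x

/-- **Exponential convergence, uniformly over a family of Markov semigroups.** Let `κ i`,
`i : ι`, be Markov semigroups (`κ i 0 = id`, Chapman–Kolmogorov) with a common Lyapunov function
`V`, a common geometric drift `κ i t₀ V ≤ γ V + K` (`γ < 1`) at a common time `t₀ > 0`, a common
minorisation `κ i t₀ (x, ·) ≥ α ν_i` on `{V ≤ R}` (`ν_i` probability measures, `α > 0`,
`2K < (1-γ)R`) and a common flow bound `κ i s V ≤ e^{C⋆ s} V`. Then there are `C, c > 0` such that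
for every `i`, every invariant probability measure `μ` of `κ i`, every `z`, `t ≥ 0` and measurable
`f` with `|f| ≤ V`: `|κ i t f(z) - μ(f)| ≤ C (1 + V z) e^{-ct}`. -/
theorem uniformHarris_semigroup {ι : Type*} [Nonempty X] (κ : ι → ℝ≥0 → Kernel X X)
    [∀ i t, IsMarkovKernel (κ i t)] (h_zero : ∀ i, κ i 0 = Kernel.id)
    (h_add : ∀ i (s t : ℝ≥0), κ i (s + t) = κ i t ∘ₖ κ i s) {V : X → ℝ≥0} (hV : Measurable V)
    {t₀ : ℝ≥0} (ht₀ : 0 < t₀) {γ K : ℝ≥0} (hγ : γ < 1)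
    (hdrift : ∀ i z, ∫⁻ y, V y ∂(κ i t₀ z) ≤ (γ : ℝ≥0∞) * V z + K)
    {α R : ℝ≥0} (hα : 0 < α) (hR : 2 * K < (1 - γ) * R)
    (ν : ι → Measure X) [∀ i, IsProbabilityMeasure (ν i)]
    (hminor : ∀ i x, V x ≤ R → α • ν i ≤ κ i t₀ x)
    {Cstar : ℝ} (hCstar : 0 ≤ Cstar)
    (hflow : ∀ i (s : ℝ≥0) (x : X), ∫⁻ y, V y ∂(κ i s x) ≤ ENNReal.ofReal (Real.exp (Cstar * s)) * V x) :
    ∃ C c : ℝ, 0 < C ∧ 0 < c ∧ ∀ (i : ι) (μ : Measure X), IsProbabilityMeasure μ →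
      (∀ t, Kernel.Invariant (κ i t) μ) →
      ∀ (z : X) (t : ℝ≥0) (f : X → ℝ), Measurable f → (∀ y, |f y| ≤ V y) →
        |∫ y, f y ∂(κ i t z) - ∫ y, f y ∂μ| ≤ C * (1 + V z) * Real.exp (-c * t) := by
  obtain ⟨abar, b, ha0, ha1', hb, hfam⟩ := uniformHarris_pow hV hγ hα hR
  have ht₀r : (0 : ℝ) < t₀ := by exact_mod_cast ht₀
  -- a uniform bound on the `V`-moment of invariant probability measures
  set mVb : ℝ := ((K / (1 - γ) : ℝ≥0) : ℝ) with hmVb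
  have hmVb0 : 0 ≤ mVb := NNReal.coe_nonneg _
  have hb0 : b ≠ 0 := hb.ne'
  set C₁ : ℝ := b⁻¹ * (2 + b * mVb) + 1 with hC₁def
  have hC₁ : 0 < C₁ := by rw [hC₁def]; positivity
  set c : ℝ := -Real.log abar / t₀ with hcdef
  have hlog : Real.log abar < 0 := Real.log_neg ha0 ha1'
  have hc : 0 < c := by rw [hcdef]; exact div_pos (by linarith) ht₀r
  refine ⟨C₁ * Real.exp (Cstar * t₀) / abar, c, by positivity, hc, fun i μ hμ hinv z t f hfm hfV => ?_⟩
  haveI := hμ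
  obtain ⟨-, hmom⟩ := hfam (κ i t₀) (hdrift i) (ν i) (hminor i)
  obtain ⟨hμVle, hgeo⟩ := hmom μ hμ (hinv t₀)
  set P : Kernel X X := κ i t₀ with hPdef
  -- the `V`-moment of `μ`
  have hμV : ∫⁻ z, V z ∂μ ≠ ∞ := ne_top_of_le_ne_top ENNReal.coe_ne_top hμVle
  set mV : ℝ := (∫⁻ z, V z ∂μ).toReal with hmV
  have hmVle : mV ≤ mVb := by
    rw [hmV, hmVb]
    exact ENNReal.toReal_le_coe_of_le_coe hμVle
  -- finiteness of the `V`-moments along the semigroup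
  have hflow' : ∀ (s : ℝ≥0) (x : X), ∫⁻ y, (V y : ℝ≥0∞) ∂(κ i s x) ≠ ∞ := fun s x =>
    ne_top_of_le_ne_top (ENNReal.mul_ne_top ENNReal.ofReal_ne_top ENNReal.coe_ne_top) (hflow i s x)
  have hfV' : ∀ y, |f y| ≤ 0 + 1 * V y := fun y => by rw [zero_add, one_mul]; exact hfV y
  have hfint : ∀ (s : ℝ≥0) (x : X), Integrable f (κ i s x) := fun s x =>
    Harris.integrable_of_abs_le_affine hV (hflow' s x) hfm hfV'
  -- Harris on the skeleton: `|Pⁿ f(x) - μ(f)| ≤ ᾱⁿ C₁ (1 + V x)`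
  have hskel : ∀ (n : ℕ) (x : X),
      |∫ y, f y ∂((P ^ n) x) - ∫ y, f y ∂μ| ≤ abar ^ n * C₁ * (1 + V x) := by
    intro n x
    have hφm : Measurable fun y => b * f y := hfm.const_mul b
    have hφ : ∀ y, |b * f y| ≤ 1 + b * V y := fun y => by
      rw [abs_mul, abs_of_pos hb]
      have := mul_le_mul_of_nonneg_left (hfV y) hb.le
      linarith
    have h := hgeo n (fun y => b * f y) hφm hφ x
    rw [integral_const_mul, integral_const_mul, ← mul_sub, abs_mul, abs_of_pos hb] at h
    have h' : |∫ y, f y ∂((P ^ n) x) - ∫ y, f y ∂μ| ≤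
        abar ^ n * (b⁻¹ * (2 + b * mV) + V x) := by
      have h1 := mul_le_mul_of_nonneg_left h (inv_nonneg.2 hb.le)
      rw [inv_mul_cancel_left₀ hb0] at h1
      refine h1.trans (le_of_eq ?_)
      rw [hmV]
      field_simp
      ring
    refine h'.trans ?_
    rw [mul_assoc]
    refine mul_le_mul_of_nonneg_left ?_ (pow_nonneg ha0.le n)
    have hVx : (0 : ℝ) ≤ V x := (V x).2
    have hmon : b⁻¹ * (2 + b * mV) ≤ b⁻¹ * (2 + b * mVb) :=
      mul_le_mul_of_nonneg_left (by nlinarith [hb.le]) (inv_nonneg.2 hb.le)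
    have hC₁' : b⁻¹ * (2 + b * mVb) ≤ C₁ := by rw [hC₁def]; linarith
    have hC₁'' : (1 : ℝ) ≤ C₁ := by
      rw [hC₁def]; linarith [show (0:ℝ) ≤ b⁻¹ * (2 + b * mVb) by positivity]
    nlinarith
  -- `t = r + n t₀`, `r < t₀`
  obtain ⟨n, r, hr, rfl⟩ := MarkovSemigroup.exists_eq_add_nat_mul_of_pos ht₀ t
  set g : X → ℝ := fun y => ∫ w, f w ∂((P ^ n) y) with hg
  have hgm : Measurable g := (hfm.stronglyMeasurable.integral_kernel (κ := P ^ n)).measurable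
  have hact : ∫ y, f y ∂(κ i (r + n * t₀) z) = ∫ y, g y ∂(κ i r z) := by
    have hint : Integrable f (((P ^ n) ∘ₖ κ i r) z) := by
      have := hfint (r + n * t₀) z
      rwa [h_add, MarkovSemigroup.kernel_nat_mul_eq_pow (κ i) (h_zero i) (h_add i)] at this
    rw [h_add, MarkovSemigroup.kernel_nat_mul_eq_pow (κ i) (h_zero i) (h_add i), ← hPdef]
    rw [Kernel.comp_apply] at hint ⊢
    exact Harris.integral_comp_measure (P ^ n) (κ i r z) hint
  rw [hact]
  have hgb : ∀ y, |g y - ∫ w, f w ∂μ| ≤ abar ^ n * C₁ * (1 + V y) := fun y => hskel n y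
  have hgi : Integrable g (κ i r z) := by
    refine Harris.integrable_of_abs_le_affine hV (hflow' r z) hgm (A := |∫ w, f w ∂μ| + abar ^ n * C₁)
      (B := abar ^ n * C₁) fun y => ?_
    have h1 := hgb y
    have h2 : |g y| ≤ |∫ w, f w ∂μ| + |g y - ∫ w, f w ∂μ| := by
      have := abs_add_le (∫ w, f w ∂μ) (g y - ∫ w, f w ∂μ); rwa [add_sub_cancel] at this
    nlinarith
  have hVi : Integrable (fun y => (V y : ℝ)) (κ i r z) :=
    Harris.integrable_coe_of_lintegral_ne_top hV (hflow' r z)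
  have hsub : (∫ y, g y ∂(κ i r z)) - ∫ w, f w ∂μ = ∫ y, (g y - ∫ w, f w ∂μ) ∂(κ i r z) := by
    rw [integral_sub hgi (integrable_const _), integral_const, probReal_univ, one_smul]
  have hPr : (∫⁻ y, (V y : ℝ≥0∞) ∂(κ i r z)).toReal ≤ Real.exp (Cstar * t₀) * V z := by
    have h1 : ∫⁻ y, (V y : ℝ≥0∞) ∂(κ i r z) ≤ ENNReal.ofReal (Real.exp (Cstar * t₀) * V z) := by
      refine (hflow i r z).trans ?_
      rw [ENNReal.ofReal_mul (Real.exp_pos _).le, ENNReal.ofReal_coe_nnreal]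
      refine mul_le_mul_of_nonneg_right (ENNReal.ofReal_le_ofReal (Real.exp_le_exp.2 ?_)) zero_le
      exact mul_le_mul_of_nonneg_left (by exact_mod_cast hr.le) hCstar
    exact ENNReal.toReal_le_of_le_ofReal (by positivity) h1
  -- `ᾱⁿ ≤ ᾱ⁻¹ e^{-ct}`
  have hpow : abar ^ n ≤ abar⁻¹ * Real.exp (-c * ((r + n * t₀ : ℝ≥0) : ℝ)) := by
    have hlogeq : Real.log abar = -c * t₀ := by
      rw [hcdef, neg_mul, div_mul_cancel₀ _ ht₀r.ne', neg_neg]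
    have hn : abar ^ n = Real.exp (n * Real.log abar) := by
      rw [Real.exp_nat_mul, Real.exp_log ha0]
    have hinv' : abar⁻¹ = Real.exp (c * t₀) := by
      have : Real.exp (c * t₀) = Real.exp (-Real.log abar) := by
        rw [hlogeq]; simp only [neg_mul, neg_neg]
      rw [this, Real.exp_neg, Real.exp_log ha0]
    rw [hn, hinv', ← Real.exp_add]
    refine Real.exp_le_exp.2 ?_
    rw [hlogeq]
    push_cast
    have hr' : ((r : ℝ≥0) : ℝ) ≤ t₀ := by exact_mod_cast hr.le
    have hc0 : 0 ≤ c := hc.le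
    nlinarith [mul_nonneg hc0 (sub_nonneg.2 hr')]
  have hE : 0 ≤ Real.exp (Cstar * t₀) := (Real.exp_pos _).le
  have hE1 : 1 ≤ Real.exp (Cstar * t₀) := Real.one_le_exp (by positivity)
  calc |(∫ y, g y ∂(κ i r z)) - ∫ w, f w ∂μ|
      = |∫ y, (g y - ∫ w, f w ∂μ) ∂(κ i r z)| := by rw [hsub]
    _ ≤ ∫ y, |g y - ∫ w, f w ∂μ| ∂(κ i r z) := abs_integral_le_integral_abs
    _ ≤ ∫ y, abar ^ n * C₁ * (1 + (V y : ℝ)) ∂(κ i r z) :=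
        integral_mono (hgi.sub (integrable_const _)).abs
          (((integrable_const _).add hVi).const_mul _) fun y => hgb y
    _ = abar ^ n * C₁ * (1 + (∫⁻ y, (V y : ℝ≥0∞) ∂(κ i r z)).toReal) := by
        rw [integral_const_mul, integral_add (integrable_const _) hVi, integral_const,
          probReal_univ, one_smul, Harris.integral_coe_eq_toReal hV]
    _ ≤ abar ^ n * C₁ * (1 + Real.exp (Cstar * t₀) * V z) := by gcongr
    _ ≤ abar ^ n * C₁ * (Real.exp (Cstar * t₀) * (1 + V z)) := by
        refine mul_le_mul_of_nonneg_left ?_ (by positivity)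
        have hVz : (0 : ℝ) ≤ V z := (V z).2
        nlinarith
    _ ≤ (abar⁻¹ * Real.exp (-c * ((r + n * t₀ : ℝ≥0) : ℝ))) * C₁ *
          (Real.exp (Cstar * t₀) * (1 + V z)) := by gcongr
    _ = C₁ * Real.exp (Cstar * t₀) / abar * (1 + V z) *
          Real.exp (-c * ((r + n * t₀ : ℝ≥0) : ℝ)) := by ring

end Summit.AtomisticToContinuum.FouriersLaw.Theorems

end
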